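import Literature.AlgebraicGeometry.HodgeTheory.RegularFormRealization
import Literature.AlgebraicGeometry.Motives.PolyFormPullbackFunctorial
import HarnessLib

/-!
# Naturality of the holomorphic image of an algebraic form (Grothendieck's comparison map (5))
# along morphisms of affine varieties

[topic AlgebraicGeometry/HodgeTheory]

Sequel of `RegularFormRealization` (Grothendieck's comparison map
`polyFormRealize` / `regularFormRealize` / `deRhamComparison`, [Grothendieck1966, (4)–(5)]) and of
`Motives/PolyFormPullback` / `Motives/PolyFormPullbackFunctorial` (the pull-back
`F^* = PolyForm.comap F` of polynomial forms along a polynomial map, `RegularForm.comap`, and the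
induced map `DeRhamCohomology.comap` on algebraic de Rham cohomology). Programme node P2-nat of the
Route-P map of the `lit-hodgefound` lane.

Let `h : Y₁ ⟶ Y₂` be a `ℂ`-morphism of smooth `ℂ`-schemes with analytic models
`A₁ : AnalyticModel E₁ m₁ Y₁`, `A₂ : AnalyticModel E₂ m₂ Y₂` (so that the analytified map
`h^an = A₁.anMap A₂ h : Y₁^an → Y₂^an` is holomorphic, `AnalyticModel.contMDiff_anMap`), coordinates
`x₁ : Fin N₁ → Γ(Y₁, 𝒪)`, `x₂ : Fin N₂ → Γ(Y₂, 𝒪)` (`coordPresentation`: `φ_x : ℂ[T] → Γ(Y, 𝒪)`),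
and a POLYNOMIAL LIFT `F : Fin N₂ → ℂ[T₁, …, T_{N₁}]` of `h` on the coordinates,
`h♯(x₂ⱼ) = φ_{x₁}(Fⱼ)` (such a lift exists as soon as `φ_{x₁}` is onto, `exists_coordLift`). Then:

* `AnalyticModel.regularFun_coordPresentation_comp_anMap` — `(φ_{x₂} f)^an ∘ h^an = (φ_{x₁}(f ∘ F))^an`
  (polynomials in the coordinates pull back by substitution; evaluation formula
  `regularFun_coordPresentation`, `regularFun_appTop`, `aeval_bind₁`);
* **`polyFormRealize_pullback_anMap`** — for every polynomial `p`-form `α` on `𝔸^{N₂}`,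
  `(h^an)^* (α^an_{A₂, x₂}) = (F^* α)^an_{A₁, x₁}`: THE HOLOMORPHIC IMAGE OF AN ALGEBRAIC FORM IS
  NATURAL, Grothendieck's (5) commutes with pull-backs [Grothendieck1966, p. 96; Hartshorne 1975,
  Ch. II Thm. (1.4): contravariant functoriality; Serre, GAGA §2 n°5: fonctorialité de `X ↦ X^h`].
  Proof: induction on the degree through the generators `dTⱼ ∧ β` (`PolyForm.eq_sum_smul_dXs`):
  `(dTⱼ ∧ β)^an = d(x₂ⱼ^an) ∧ β^an` (`polyFormRealize_dWedge`), `(h^an)^*` commutes with `d` on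
  functions and with `∧` (`dFun_pullback`, `MForm.pullback_wedge`), `x₂ⱼ^an ∘ h^an = (φ_{x₁} Fⱼ)^an`,
  and `F^*(dTⱼ ∧ β) = dFⱼ ∧ F^*β` (`PolyForm.comap_dWedge`); degree `0` is the first bullet;
* `coordPresentation_bind₁` — `φ_{x₁} ∘ F♯ = h♯ ∘ φ_{x₂}` (`F` lifts `h♯`; uses that `h♯` fixes the
  scalars, `appTop_scalarRingHom`), whence `map_le_ker_coordPresentation`: relations among the
  `x₂` are carried to relations among the `x₁` (`I₂ ≤ ker φ_{x₂} ⇒ I₂·F♯ ≤ ker φ_{x₁}`);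
* **`regularFormRealize_pullback_anMap`** — the same naturality on REGULAR forms
  `Ω^p(V(I₂)) → Ω^p(V(I₁))` (`RegularForm.comap F`, for `I₂·F♯ ≤ I₁ ≤ ker φ_{x₁}`), i.e. the
  square "(5) ∘ F^* = (h^an)^* ∘ (5)" on the cochain level, and on algebraic de Rham cohomology
  **`deRhamComparison_comp_comap`**:
  `deRhamComparison A₁ x₁ ∘ DeRhamCohomology.comap F = (h^an)^* ∘ deRhamComparison A₂ x₂` —
  GROTHENDIECK'S COMPARISON MAP (5) IS A NATURAL TRANSFORMATION `H_dR(V(I)/ℂ) ⇒ H_dR(Y^an; ℂ)`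
  (pointwise `deRhamComparison_map_eq`).

All statements are theorems (no named facts); the carriers are those of TRIBUNAL-B ruling 31
(`PolyForm` / `RegularForm` / `DeRhamCohomology` ↔ `MForm` / `complexDeRhamCohomology`).

## References

* [Grothendieck1966] A. Grothendieck, *On the de Rham cohomology of algebraic varieties*, Publ.
  Math. IHÉS 29 (1966), p. 96: (4) (affine hypercohomology = global forms), (5) (the comparison
  homomorphism, "the holomorphic image of an algebraic form"), functorial in `X`.
* [Hartshorne1975] R. Hartshorne, *On the de Rham cohomology of algebraic varieties*, Publ. Math.
  IHÉS 45 (1975), Ch. II §1, Thm. (1.4), p. 27 (algebraic de Rham cohomology is a contravariant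
  functor in `Y`; Ch. IV §1 compares functorially with `Y^h`).
* [SerreGAGA1956] J.-P. Serre, *Géométrie algébrique et géométrie analytique*, Ann. Inst. Fourier 6
  (1956), §2 n°5 (fonctorialité de `X ↦ X^h`).
* [Warner1983] F. Warner, *Foundations of differentiable manifolds and Lie groups*, 2.22–2.23
  (`f^*` commutes with `∧` and `d`).
-/

noncomputable section

open scoped Manifold ContDiff
open CategoryTheory AlgebraicGeometry MvPolynomial
open Literature.NumberTheory.Transcendental Literature.Geometry.Kaehler
open Literature.AlgebraicGeometry.Motives Literature.AlgebraicGeometry.Motives.AffineDeRham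

namespace Literature.AlgebraicGeometry.HodgeTheory

section HodgeTheory

variable {E₁ : Type} [NormedAddCommGroup E₁] [NormedSpace ℂ E₁] [FiniteDimensional ℂ E₁]
  {E₂ : Type} [NormedAddCommGroup E₂] [NormedSpace ℂ E₂] [FiniteDimensional ℂ E₂]
  {m₁ m₂ : ℕ} {Y₁ Y₂ : Motives.SchemeOver ℂ} {N₁ N₂ : ℕ}

/-! ### Lifting a morphism to the coordinates -/

/-- A `ℂ`-morphism `h : Y₁ ⟶ Y₂` over `Spec ℂ` fixes the scalars: `h♯(c · 1) = c · 1`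
(both structure maps come from `Γ(Spec ℂ, 𝒪) = ℂ` and `Y₁ → Spec ℂ` factors through `h`).
[cite: Hartshorne1977, II Ex. 2.4] -/
theorem appTop_scalarRingHom (h : Y₁ ⟶ Y₂) (c : ℂ) :
    h.left.appTop (SchemeOver.scalarRingHom Y₂ ⊤ c) = SchemeOver.scalarRingHom Y₁ ⊤ c := by
  have h2 : h.left.appLE ⊤ ⊤ le_top = h.left.appTop := Scheme.Hom.appLE_eq_app _
  rw [SchemeOver.scalarRingHom_apply, SchemeOver.scalarRingHom_apply, ← h2,
    ← CommRingCat.comp_apply, Scheme.Hom.appLE_comp_appLE]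
  have key : ∀ (g : Y₁.left ⟶ Spec (.of ℂ)) (_ : g = Y₁.hom) (e' : (⊤ : Y₁.left.Opens) ≤ g ⁻¹ᵁ ⊤),
      g.appLE ⊤ ⊤ e' = Y₁.hom.appLE ⊤ ⊤ le_top := by
    rintro _ rfl _; rfl
  rw [key _ (Over.w h)]

/-- **A polynomial lift of `h♯` on the coordinates intertwines the presentations**: if
`h♯(x₂ⱼ) = φ_{x₁}(Fⱼ)` for all `j`, then `φ_{x₁}(f(F)) = h♯(φ_{x₂} f)` for every polynomial `f`, i.e.
`φ_{x₁} ∘ F♯ = h♯ ∘ φ_{x₂}` (two ring maps out of `ℂ[T]` agreeing on the variables and on the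
scalars). [cite: Hartshorne1977, II §3] -/
theorem coordPresentation_bind₁ (h : Y₁ ⟶ Y₂) {x₁ : Fin N₁ → Γ(Y₁.left, ⊤)}
    {x₂ : Fin N₂ → Γ(Y₂.left, ⊤)} {F : Fin N₂ → MvPolynomial (Fin N₁) ℂ}
    (hF : ∀ j, h.left.appTop (x₂ j) = coordPresentation Y₁ x₁ (F j)) (f : MvPolynomial (Fin N₂) ℂ) :
    coordPresentation Y₁ x₁ (bind₁ F f) = h.left.appTop (coordPresentation Y₂ x₂ f) := by
  suffices hc : (coordPresentation Y₁ x₁).comp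
      (bind₁ F : MvPolynomial (Fin N₂) ℂ →ₐ[ℂ] MvPolynomial (Fin N₁) ℂ).toRingHom =
        h.left.appTop.hom.comp (coordPresentation Y₂ x₂) from
    DFunLike.congr_fun hc f
  refine MvPolynomial.ringHom_ext (fun c ↦ ?_) (fun j ↦ ?_)
  · rw [RingHom.comp_apply, RingHom.comp_apply, AlgHom.toRingHom_eq_coe, AlgHom.coe_toRingHom,
      bind₁_C_right, coordPresentation_C, coordPresentation_C]
    exact (appTop_scalarRingHom h c).symm
  · rw [RingHom.comp_apply, RingHom.comp_apply, AlgHom.toRingHom_eq_coe, AlgHom.coe_toRingHom,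
      bind₁_X_right, coordPresentation_X]
    exact (hF j).symm

/-- **Relations are carried to relations**: for a lift `F` of `h♯` on the coordinates and an ideal
`I₂ ⊆ ker φ_{x₂}` of relations among the `x₂`, the ideal `I₂·F♯` consists of relations among the
`x₁`: `I₂.map F♯ ≤ ker φ_{x₁}`. [cite: Hartshorne1977, II §3] -/
theorem map_le_ker_coordPresentation (h : Y₁ ⟶ Y₂) {x₁ : Fin N₁ → Γ(Y₁.left, ⊤)}
    {x₂ : Fin N₂ → Γ(Y₂.left, ⊤)} {F : Fin N₂ → MvPolynomial (Fin N₁) ℂ}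
    (hF : ∀ j, h.left.appTop (x₂ j) = coordPresentation Y₁ x₁ (F j))
    {I₂ : Ideal (MvPolynomial (Fin N₂) ℂ)} (hI₂ : I₂ ≤ RingHom.ker (coordPresentation Y₂ x₂)) :
    I₂.map (bind₁ F : MvPolynomial (Fin N₂) ℂ →ₐ[ℂ] MvPolynomial (Fin N₁) ℂ) ≤
      RingHom.ker (coordPresentation Y₁ x₁) := by
  rw [Ideal.map_le_iff_le_comap]
  intro f hf
  rw [Ideal.mem_comap, RingHom.mem_ker, coordPresentation_bind₁ h hF,
    RingHom.mem_ker.1 (hI₂ hf), map_zero]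

/-- **Lifts exist for a presentation**: if `φ_{x₁}` is onto, every `ℂ`-morphism `h : Y₁ ⟶ Y₂` admits a
polynomial lift on any coordinates `x₂` of `Y₂` (choose preimages of the `h♯(x₂ⱼ)`).
[cite: Hartshorne1977, II §3] -/
theorem exists_coordLift (h : Y₁ ⟶ Y₂) {x₁ : Fin N₁ → Γ(Y₁.left, ⊤)}
    (hx₁ : Function.Surjective (coordPresentation Y₁ x₁)) (x₂ : Fin N₂ → Γ(Y₂.left, ⊤)) :
    ∃ F : Fin N₂ → MvPolynomial (Fin N₁) ℂ, ∀ j, h.left.appTop (x₂ j) = coordPresentation Y₁ x₁ (F j) :=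
  ⟨fun j ↦ (hx₁ (h.left.appTop (x₂ j))).choose, fun j ↦ ((hx₁ (h.left.appTop (x₂ j))).choose_spec).symm⟩

/-! ### Naturality of the holomorphic image -/

section Naturality

variable [IsAffine Y₁.left] [IsAffine Y₂.left] [SmoothOfRelativeDimension m₁ Y₁.hom]
  [SmoothOfRelativeDimension m₂ Y₂.hom]
  (A₁ : AnalyticModel E₁ m₁ Y₁) (A₂ : AnalyticModel E₂ m₂ Y₂) (h : Y₁ ⟶ Y₂)
  {x₁ : Fin N₁ → Γ(Y₁.left, ⊤)} {x₂ : Fin N₂ → Γ(Y₂.left, ⊤)}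
  {F : Fin N₂ → MvPolynomial (Fin N₁) ℂ}

omit [IsAffine Y₁.left] [IsAffine Y₂.left] [SmoothOfRelativeDimension m₁ Y₁.hom]
  [SmoothOfRelativeDimension m₂ Y₂.hom] in
/-- **Polynomials in the coordinates pull back by substitution**: for a lift `F` of `h♯` on the
coordinates, `(φ_{x₂} f)^an ∘ h^an = (φ_{x₁}(f(F)))^an` on `Y₁^an` (read both sides at a point
through the evaluation formula `(φ_x g)^an(z) = g(x^an(z))` and `x₂ⱼ^an ∘ h^an = (h♯ x₂ⱼ)^an = (φ_{x₁} Fⱼ)^an`).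
[cite: SerreGAGA1956, §2 n°5] -/
theorem AnalyticModel.regularFun_coordPresentation_comp_anMap
    (hF : ∀ j, h.left.appTop (x₂ j) = coordPresentation Y₁ x₁ (F j)) (f : MvPolynomial (Fin N₂) ℂ) :
    A₂.regularFun (coordPresentation Y₂ x₂ f) ∘ A₁.anMap A₂ h =
      A₁.regularFun (coordPresentation Y₁ x₁ (bind₁ F f)) := by
  funext z
  rw [Function.comp_apply]
  induction f using MvPolynomial.induction_on with
  | C c =>
    rw [coordPresentation_C, bind₁_C_right, coordPresentation_C, A₂.regularFun_scalarRingHom,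
      A₁.regularFun_scalarRingHom]
  | add f g hf hg =>
    simp only [map_add, A₂.regularFun_add, A₁.regularFun_add, hf, hg]
  | mul_X f j hf =>
    simp only [map_mul, coordPresentation_X, bind₁_X_right, A₂.regularFun_mul', A₁.regularFun_mul',
      hf]
    rw [← hF j, A₁.regularFun_appTop A₂ h (x₂ j), Function.comp_apply]

/-- **Naturality of the holomorphic image of an algebraic form** [Grothendieck1966, (5)]: for a
`ℂ`-morphism `h : Y₁ ⟶ Y₂` of smooth affine `ℂ`-schemes, analytic models `A₁`, `A₂`, coordinates
`x₁`, `x₂` and a polynomial lift `F` of `h♯` on the coordinates (`h♯(x₂ⱼ) = φ_{x₁}(Fⱼ)`), the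
holomorphic image commutes with pull-back: `(h^an)^* (α^an) = (F^* α)^an` for every polynomial
`p`-form `α` — Grothendieck's comparison (5) is functorial (Hartshorne 1975, Ch. II Thm. 1.4;
Serre, GAGA §2 n°5). Induction on `p` through the generators `dTⱼ ∧ β`: `(h^an)^*` commutes with `d`
on functions and with `∧` (Warner 2.22–2.23), and `F^*(dTⱼ ∧ β) = dFⱼ ∧ F^*β`.
[cite: Grothendieck1966, (5)] -/
theorem polyFormRealize_pullback_anMap
    (hF : ∀ j, h.left.appTop (x₂ j) = coordPresentation Y₁ x₁ (F j)) {p : ℕ} (α : PolyForm ℂ N₂ p) :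
    (polyFormRealize A₂ x₂ p α).pullback 𝓘(ℝ, E₁) (A₁.anMap A₂ h) =
      polyFormRealize A₁ x₁ p (PolyForm.comap F α) := by
  have hφ := A₁.contMDiff_anMap A₂ h
  induction p with
  | zero =>
    obtain ⟨f, rfl⟩ := (ofPoly (k := ℂ) (n := N₂)).surjective α
    rw [polyFormRealize_ofPoly, PolyForm.comap_ofPoly, polyFormRealize_ofPoly, pullback_ofFun,
      A₁.regularFun_coordPresentation_comp_anMap A₂ h hF]
  | succ p ih =>
    refine dWedge_X_induction
      (C := fun α ↦ (polyFormRealize A₂ x₂ (p + 1) α).pullback 𝓘(ℝ, E₁) (A₁.anMap A₂ h) =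
        polyFormRealize A₁ x₁ (p + 1) (PolyForm.comap F α))
      (by rw [map_zero, map_zero, map_zero, MForm.pullback_zero]) (fun a b ha hb ↦ ?_)
      (fun j β ↦ ?_) α
    · rw [map_add, map_add, map_add, MForm.pullback_add, ha, hb]
    · rw [polyFormRealize_dWedge, MForm.pullback_castDeg, MForm.pullback_wedge,
        dFun_pullback hφ (A₂.isSmoothForm_ofFun_regularFun _), ih β,
        A₁.regularFun_coordPresentation_comp_anMap A₂ h hF, PolyForm.comap_dWedge, bind₁_X_right,
        polyFormRealize_dWedge]

/-- **Naturality of the holomorphic image on regular forms** (the cochain-level square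
"`(h^an)^* ∘ (5) = (5) ∘ F^*`"): for ideals of relations `I₂ ⊆ ker φ_{x₂}`, `I₁ ⊆ ker φ_{x₁}` with
`I₂·F♯ ⊆ I₁` (`F` maps `V(I₁)` into `V(I₂)`), and every regular `p`-form `r` on `V(I₂)`:
`(h^an)^* (r^an) = (F^* r)^an`. [cite: Grothendieck1966, (5)] -/
theorem regularFormRealize_pullback_anMap
    (hF : ∀ j, h.left.appTop (x₂ j) = coordPresentation Y₁ x₁ (F j))
    {I₁ : Ideal (MvPolynomial (Fin N₁) ℂ)} {I₂ : Ideal (MvPolynomial (Fin N₂) ℂ)}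
    (hI₁ : I₁ ≤ RingHom.ker (coordPresentation Y₁ x₁))
    (hI₂ : I₂ ≤ RingHom.ker (coordPresentation Y₂ x₂))
    (hFI : I₂.map (bind₁ F : MvPolynomial (Fin N₂) ℂ →ₐ[ℂ] MvPolynomial (Fin N₁) ℂ) ≤ I₁)
    (p : ℕ) (r : RegularForm I₂ p) :
    (regularFormRealize A₂ x₂ hI₂ p r).pullback 𝓘(ℝ, E₁) (A₁.anMap A₂ h) =
      regularFormRealize A₁ x₁ hI₁ p (RegularForm.comap F hFI p r) := by
  obtain ⟨α, rfl⟩ := RegularForm.mk_surjective I₂ r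
  rw [regularFormRealize_mk, RegularForm.comap_mk, regularFormRealize_mk,
    polyFormRealize_pullback_anMap A₁ A₂ h hF]

/-- **Grothendieck's comparison map (5) is natural**: for a `ℂ`-morphism `h : Y₁ ⟶ Y₂` of smooth
affine `ℂ`-schemes with a polynomial lift `F` on coordinates, and ideals of relations
`I₂ ⊆ ker φ_{x₂}`, `I₁ ⊆ ker φ_{x₁}` with `I₂·F♯ ⊆ I₁`, the square
`deRhamComparison₁ ∘ F^* = (h^an)^* ∘ deRhamComparison₂ : H^p_dR(V(I₂)) → H^p_dR(Y₁^an; ℂ)`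
commutes — (5) is a natural transformation from algebraic to analytic de Rham cohomology
[Grothendieck1966, p. 96; Hartshorne 1975, Ch. II Thm. 1.4 and Ch. IV §1].
[cite: Grothendieck1966, (5)] -/
theorem deRhamComparison_comp_comap
    (hF : ∀ j, h.left.appTop (x₂ j) = coordPresentation Y₁ x₁ (F j))
    {I₁ : Ideal (MvPolynomial (Fin N₁) ℂ)} {I₂ : Ideal (MvPolynomial (Fin N₂) ℂ)}
    (hI₁ : I₁ ≤ RingHom.ker (coordPresentation Y₁ x₁))
    (hI₂ : I₂ ≤ RingHom.ker (coordPresentation Y₂ x₂))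
    (hFI : I₂.map (bind₁ F : MvPolynomial (Fin N₂) ℂ →ₐ[ℂ] MvPolynomial (Fin N₁) ℂ) ≤ I₁) (p : ℕ) :
    deRhamComparison A₁ x₁ hI₁ p ∘ₗ DeRhamCohomology.comap F hFI p =
      complexDeRhamCohomology.map E₁ (A₁.contMDiff_anMap A₂ h) p ∘ₗ deRhamComparison A₂ x₂ hI₂ p := by
  refine LinearMap.ext fun c ↦ ?_
  obtain ⟨r, rfl⟩ := DeRhamCohomology.mk_surjective I₂ c
  rw [LinearMap.comp_apply, LinearMap.comp_apply, DeRhamCohomology.comap_mk, deRhamComparison_mk,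
    deRhamComparison_mk, complexDeRhamCohomology.map_mk]
  congr 1
  exact Subtype.ext (regularFormRealize_pullback_anMap A₁ A₂ h hF hI₁ hI₂ hFI p r).symm

/-- **Naturality of (5) on classes**: `(h^an)^* (deRhamComparison₂ c) = deRhamComparison₁ (F^* c)` for
every algebraic de Rham class `c` of `V(I₂)`. [cite: Grothendieck1966, (5)] -/
theorem deRhamComparison_map_eq
    (hF : ∀ j, h.left.appTop (x₂ j) = coordPresentation Y₁ x₁ (F j))
    {I₁ : Ideal (MvPolynomial (Fin N₁) ℂ)} {I₂ : Ideal (MvPolynomial (Fin N₂) ℂ)}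
    (hI₁ : I₁ ≤ RingHom.ker (coordPresentation Y₁ x₁))
    (hI₂ : I₂ ≤ RingHom.ker (coordPresentation Y₂ x₂))
    (hFI : I₂.map (bind₁ F : MvPolynomial (Fin N₂) ℂ →ₐ[ℂ] MvPolynomial (Fin N₁) ℂ) ≤ I₁) (p : ℕ)
    (c : DeRhamCohomology I₂ p) :
    complexDeRhamCohomology.map E₁ (A₁.contMDiff_anMap A₂ h) p (deRhamComparison A₂ x₂ hI₂ p c) =
      deRhamComparison A₁ x₁ hI₁ p (DeRhamCohomology.comap F hFI p c) := by
  have hc := LinearMap.congr_fun (deRhamComparison_comp_comap A₁ A₂ h hF hI₁ hI₂ hFI p) c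
  simp only [LinearMap.comp_apply] at hc
  exact hc.symm

end Naturality

end HodgeTheory

end Literature.AlgebraicGeometry.HodgeTheory

end
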